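import Literature.Analysis.FluidPDE.TaoAnnulusEnstrophyInequality
import HarnessLib

/-!
# Tao (2011/2013), proof of Thm. 10.1 WITH FORCE: the integrated enstrophy inequality along the
# moving annular cutoff, keeping the forcing term `Y₅ = ∫ ⟨ω, ∇ × f⟩ η`

Cell `pub/ns-blowup`, seat `ns-blowup-lean2` (PATH A of the E–C route's Literature leaf W14 =
`tao2011_forced_unconditionalUniqueness_velocity`, Tao 2011 Cor. 11.4 = arXiv Cor. 71 WITH force).
WHAT THIS IS NOT: not a statement about Navier–Stokes blow-up — it is the forced twin of a proved
brick of the tree's `f = 0` formalisation of T. Tao, *Localisation and compactness properties of the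
Navier–Stokes global regularity problem*, Anal. PDE 6 (2013) = arXiv:1108.1165, §10.

The tree proves the §10 enstrophy inequality (proof of Thm. 10.1 = arXiv Thm. 59, pp. 30–33, in the
annular geometry of Remark 10.6, unit viscosity) for the HOMOGENEOUS system only
(`enstrophyProduction_sub_recession_le`, `localisedEnstrophy_add_intervalIntegral_le`,
`TaoAnnulusEnstrophyInequality.lean`: there `f = 0`, so Tao's forcing term `Y₅` vanishes and the slot
`a(t) W^{1/2}` of the differential inequality is filled with `a = 0`). The printed theorem carries a
force: the vorticity equation is `∂ₜω + (u·∇)ω = Δω + O(ω∇u) + ∇ × f` ((10.9)), the enstrophy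
identity (10.11) has the extra term `Y₅ = ∫ ω · (∇ × f) η`, and "by Cauchy–Schwarz and (10.15) we have
`|Y₅| ≲ W^{1/2} a(t)` where `a(t) := ‖∇ × f‖_{L²_x(B(0,R))}`. Note from (10.1) that `∫₀ᵀ a(t) dt ≲ δ`"
(arXiv p. 31). Every other brick of the tree's §10 argument is already stated for a general smooth
force (`integral_enstrophyProduction_mul_weight` carries `Y₅`; the kinematic identity
`localisedEnstrophy_movingCutoff_sub_eq`, the heat-flux bound, the transport bound, the nonlinear
estimate `Y₆` and the continuity step `tao2011_enstrophy_continuity_step_integral` — which already has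
the slot `a s * √(W s)` with `∫₀ᵀ a ≤ Kδ` — do not see the force). This file supplies the two forced
twins, with

  `a(t) = √2 · ‖∇ × f(t)‖_{L²({R₁' < |x − x₀| < R₂'})}`

(the annulus containing the support of the cutoff; `√2` because `W = ½∫|ω|²η`):

* `integral_inner_mul_weight_le_forceRate` — the Cauchy–Schwarz bound `Y₅ ≤ a(t) W^{1/2}`;
* `enstrophyProduction_sub_recession_le_forced` — the fixed-time inequality
  `∫⟨ω,∂ₜω⟩η − (k/c)s·½∫_{layers}|ω|² ≤ −Y₁ + K(c^{1/20}δ⁻¹W^{1/2}Y₁ + c^{-3/20}δ³W^{3/2} + c^{3/4}W/T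
   + a W^{1/2} + b)` for a classical solution of the FORCED unit-viscosity system;
* `continuousOn_forceRate` — continuity of `a` on `[0, T]` (the force is smooth on the closed slab);
* `localisedEnstrophy_add_intervalIntegral_le_forced` — the integrated inequality
  `W(t) + ∫₀ᵗ Y₁ ≤ W(0) + ∫₀ᵗ K(… + a W^{1/2} + b)` along the moving cutoff, in exactly the shape
  consumed by `tao2011_enstrophy_continuity_step_integral`.

Everything is proved; no definition and no named fact is introduced (D-0026). The proofs are the
tree's `f = 0` proofs with the `Y₅` term kept.

## Mathlib / tree search

Tree: `enstrophyProduction_sub_recession_le`, `localisedEnstrophy_add_intervalIntegral_le`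
(`f = 0`, `TaoAnnulusEnstrophyInequality.lean`); force-general bricks
`integral_enstrophyProduction_mul_weight` (`TaoEnstrophyIdentity`), `heatFlux_le`,
`mul_setIntegral_layer_inv_norm_le`, `continuousOn_setIntegral_shell_curl_sq` (`TaoHeatFlux`,
`TaoAnnulusHeatFlux`), `localisedEnstrophy_movingCutoff_sub_eq`,
`continuousOn_localisedEnstrophy(_Dissipation)_movingCutoff` (`TaoLocalisedEnstrophy`), the speed
integral (`TaoSpeedIntegral`). `lean search 'forceRate|_le_forced' --decl` in FluidPDE: no forced §10
inequality existed. Mathlib: `integral_mul_le_Lp_mul_Lq_of_nonneg` (Cauchy–Schwarz).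

## References

* T. Tao, *Localisation and compactness properties of the Navier–Stokes global regularity
  problem*, Anal. PDE 6 (2013) 25–107 = arXiv:1108.1165 (`Tao2011`), §10, proof of Thm. 10.1
  (arXiv Thm. 59): (10.1), (10.9), (10.11), the terms `Y₁, …, Y₆` and the bound on `Y₅`, arXiv
  pp. 30–33; Remark 10.6 (arXiv Rem. 64).
-/

noncomputable section

open MeasureTheory Set Function Filter intervalIntegral
open scoped ENNReal NNReal Topology RealInnerProductSpace ContDiff

namespace Literature.Analysis.FluidPDE

/-! ## The forcing term `Y₅`: Cauchy–Schwarz -/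

section ForceRate

/-- Cauchy–Schwarz for real integrals of nonnegative functions, `∫ F G ≤ √(∫ F²) √(∫ G²)`
(file-internal; the tree's `integral_mul_le_sqrt_mul_sqrt` lives in a heavier module). [folklore] -/
private theorem integral_mul_le_sqrt_mul_sqrt_aux {α : Type*} [MeasurableSpace α] {μ : Measure α}
    {F G : α → ℝ} (hF0 : ∀ x, 0 ≤ F x) (hG0 : ∀ x, 0 ≤ G x)
    (hFm : AEStronglyMeasurable F μ) (hGm : AEStronglyMeasurable G μ)
    (hF : Integrable (fun x => F x ^ 2) μ) (hG : Integrable (fun x => G x ^ 2) μ) :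
    ∫ x, F x * G x ∂μ ≤ Real.sqrt (∫ x, F x ^ 2 ∂μ) * Real.sqrt (∫ x, G x ^ 2 ∂μ) := by
  have h := integral_mul_le_Lp_mul_Lq_of_nonneg (μ := μ) Real.HolderConjugate.two_two
    (Eventually.of_forall hF0) (Eventually.of_forall hG0)
    (by rw [ENNReal.ofReal_ofNat]; exact (memLp_two_iff_integrable_sq hFm).2 hF)
    (by rw [ENNReal.ofReal_ofNat]; exact (memLp_two_iff_integrable_sq hGm).2 hG)
  simp only [Real.rpow_two] at h
  rwa [Real.sqrt_eq_rpow, Real.sqrt_eq_rpow]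

/-- **Tao's bound on the forcing term, "`|Y₅| ≲ W^{1/2} a(t)` by Cauchy–Schwarz and (10.15)"**
(arXiv p. 31): for continuous fields `v` (vorticity `ω = curl v`) and `g` (= `∇ × f(t)`), a
continuous compactly supported weight `0 ≤ η ≤ 1` vanishing off a measurable set `S` on which
`|g|²` is integrable,
`∫ ⟨ω, g⟩ η ≤ √2 ‖g‖_{L²(S)} W^{1/2}`, `W = ½∫|ω|²η` (`localisedEnstrophy η v`).
[cite: Tao2011, §10, proof of Thm. 10.1 (the bound on Y₅, arXiv p. 31)] -/
theorem integral_inner_curl_mul_weight_le_forceRate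
    {v g : EuclideanSpace ℝ (Fin 3) → EuclideanSpace ℝ (Fin 3)}
    (hv : Continuous (FluidPDE.curl v)) (hg : Continuous g) {η : EuclideanSpace ℝ (Fin 3) → ℝ}
    (hηc : Continuous η) (hηs : HasCompactSupport η) (hη0 : ∀ x, 0 ≤ η x) (hη1 : ∀ x, η x ≤ 1)
    {S : Set (EuclideanSpace ℝ (Fin 3))} (hS : MeasurableSet S)
    (hgS : IntegrableOn (fun x => ‖g x‖ ^ 2) S volume) (hsupp : ∀ x, η x ≠ 0 → x ∈ S) :
    ∫ x, ⟪FluidPDE.curl v x, g x⟫ * η x ≤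
      Real.sqrt 2 * Real.sqrt (∫ x in S, ‖g x‖ ^ 2) * Real.sqrt (localisedEnstrophy η v) := by
  set ζ : EuclideanSpace ℝ (Fin 3) → EuclideanSpace ℝ (Fin 3) := FluidPDE.curl v with hζdef
  -- the two Cauchy–Schwarz factors
  set F : EuclideanSpace ℝ (Fin 3) → ℝ := fun x => ‖g x‖ * Real.sqrt (η x) with hFdef
  set G : EuclideanSpace ℝ (Fin 3) → ℝ := fun x => ‖ζ x‖ * Real.sqrt (η x) with hGdef
  have hsq : ∀ x, Real.sqrt (η x) * Real.sqrt (η x) = η x := fun x => Real.mul_self_sqrt (hη0 x)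
  have hF2 : ∀ x, F x ^ 2 = ‖g x‖ ^ 2 * η x := fun x => by
    simp only [hFdef]; rw [mul_pow, sq (Real.sqrt _), hsq]
  have hG2 : ∀ x, G x ^ 2 = ‖ζ x‖ ^ 2 * η x := fun x => by
    simp only [hGdef]; rw [mul_pow, sq (Real.sqrt _), hsq]
  have hFG : ∀ x, F x * G x = ‖g x‖ * ‖ζ x‖ * η x := fun x => by
    simp only [hFdef, hGdef]
    calc ‖g x‖ * Real.sqrt (η x) * (‖ζ x‖ * Real.sqrt (η x))
        = ‖g x‖ * ‖ζ x‖ * (Real.sqrt (η x) * Real.sqrt (η x)) := by ring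
      _ = ‖g x‖ * ‖ζ x‖ * η x := by rw [hsq]
  -- integrability (continuous integrands with compact support)
  have hηsq : Continuous fun x => Real.sqrt (η x) := Real.continuous_sqrt.comp hηc
  have hFc : Continuous F := hg.norm.mul hηsq
  have hGc : Continuous G := hv.norm.mul hηsq
  have hF2c : Continuous fun x => ‖g x‖ ^ 2 * η x := (hg.norm.pow 2).mul hηc
  have hG2c : Continuous fun x => ‖ζ x‖ ^ 2 * η x := (hv.norm.pow 2).mul hηc
  have hF2i : Integrable fun x => F x ^ 2 := by
    simp_rw [hF2]; exact hF2c.integrable_of_hasCompactSupport hηs.mul_left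
  have hG2i : Integrable fun x => G x ^ 2 := by
    simp_rw [hG2]; exact hG2c.integrable_of_hasCompactSupport hηs.mul_left
  have hLi : Integrable fun x => ⟪ζ x, g x⟫ * η x :=
    ((hv.inner hg).mul hηc).integrable_of_hasCompactSupport hηs.mul_left
  have hRi : Integrable fun x => F x * G x := by
    simp_rw [hFG]; exact ((hg.norm.mul hv.norm).mul hηc).integrable_of_hasCompactSupport hηs.mul_left
  -- pointwise: ⟨ω, g⟩ η ≤ |g| |ω| η
  have hpt : ∀ x, ⟪ζ x, g x⟫ * η x ≤ F x * G x := fun x => by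
    rw [hFG]
    have h1 : ⟪ζ x, g x⟫ ≤ ‖g x‖ * ‖ζ x‖ := by
      rw [mul_comm]; exact real_inner_le_norm _ _
    exact mul_le_mul_of_nonneg_right h1 (hη0 x)
  have h1 : ∫ x, ⟪ζ x, g x⟫ * η x ≤ ∫ x, F x * G x := integral_mono hLi hRi hpt
  -- Cauchy–Schwarz
  have h2 : ∫ x, F x * G x ≤ Real.sqrt (∫ x, F x ^ 2) * Real.sqrt (∫ x, G x ^ 2) :=
    integral_mul_le_sqrt_mul_sqrt_aux (fun x => by positivity) (fun x => by positivity)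
      hFc.aestronglyMeasurable hGc.aestronglyMeasurable hF2i hG2i
  -- ∫ |g|² η ≤ ∫_S |g|²
  have h3 : ∫ x, F x ^ 2 ≤ ∫ x in S, ‖g x‖ ^ 2 := by
    simp_rw [hF2]
    have hzero : ∀ x, x ∉ S → ‖g x‖ ^ 2 * η x = 0 := fun x hx => by
      have : η x = 0 := by
        by_contra h
        exact hx (hsupp x h)
      rw [this, mul_zero]
    rw [← setIntegral_eq_integral_of_forall_compl_eq_zero (s := S) (fun x hx => hzero x hx)]
    refine setIntegral_mono_on ((hF2c.integrable_of_hasCompactSupport hηs.mul_left).integrableOn)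
      hgS hS fun x _ => ?_
    calc ‖g x‖ ^ 2 * η x ≤ ‖g x‖ ^ 2 * 1 := mul_le_mul_of_nonneg_left (hη1 x) (sq_nonneg _)
      _ = ‖g x‖ ^ 2 := mul_one _
  -- ∫ |ω|² η = 2 W
  have h4 : ∫ x, G x ^ 2 = 2 * localisedEnstrophy η v := by
    simp_rw [hG2]; rw [localisedEnstrophy_def]; ring
  have hW0 : 0 ≤ localisedEnstrophy η v := localisedEnstrophy_nonneg hη0 v
  calc ∫ x, ⟪ζ x, g x⟫ * η x ≤ Real.sqrt (∫ x, F x ^ 2) * Real.sqrt (∫ x, G x ^ 2) := h1.trans h2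
    _ ≤ Real.sqrt (∫ x in S, ‖g x‖ ^ 2) * Real.sqrt (2 * localisedEnstrophy η v) := by
        rw [← h4]
        exact mul_le_mul_of_nonneg_right (Real.sqrt_le_sqrt h3) (Real.sqrt_nonneg _)
    _ = Real.sqrt 2 * Real.sqrt (∫ x in S, ‖g x‖ ^ 2) * Real.sqrt (localisedEnstrophy η v) := by
        rw [Real.sqrt_mul (by norm_num : (0 : ℝ) ≤ 2)]; ring

/-- **Continuity of the force rate** `a(t) = √2 ‖∇ × f(t)‖_{L²({R₁' < |x−x₀| < R₂'})}` on `[0, T]`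
for a force jointly smooth on the closed slab (`0 ≤ R₁'`). [cite: Tao2011, §10, proof of Thm. 10.1 (the quantity a(t))] -/
theorem continuousOn_forceRate {T : ℝ} (hT : 0 < T)
    {f : ℝ → EuclideanSpace ℝ (Fin 3) → EuclideanSpace ℝ (Fin 3)}
    (hf : FluidPDE.IsSmoothSpaceTimeOn (Icc 0 T) f) (x₀ : EuclideanSpace ℝ (Fin 3)) {R₁' R₂' : ℝ}
    (hR₁ : 0 ≤ R₁') :
    ContinuousOn (fun t => Real.sqrt 2 * Real.sqrt (∫ x in {x : EuclideanSpace ℝ (Fin 3) |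
      R₁' < ‖x - x₀‖ ∧ ‖x - x₀‖ < R₂'}, ‖FluidPDE.curl (f t) x‖ ^ 2)) (Icc 0 T) :=
  continuousOn_const.mul (continuousOn_setIntegral_shell_curl_sq hT hf x₀ (b := R₂') hR₁).sqrt

/-- The force rate `a(t) = √2‖∇ × f(t)‖_{L²}` is nonnegative. [cite: Tao2011, §10, proof of Thm. 10.1 (the quantity a(t))] -/
theorem forceRate_nonneg (f : ℝ → EuclideanSpace ℝ (Fin 3) → EuclideanSpace ℝ (Fin 3))
    (x₀ : EuclideanSpace ℝ (Fin 3)) (R₁' R₂' t : ℝ) :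
    0 ≤ Real.sqrt 2 * Real.sqrt (∫ x in {x : EuclideanSpace ℝ (Fin 3) |
      R₁' < ‖x - x₀‖ ∧ ‖x - x₀‖ < R₂'}, ‖FluidPDE.curl (f t) x‖ ^ 2) := by
  positivity

end ForceRate

/-! ## The enstrophy inequality at a fixed time, with force -/

section StaticRate

variable {T : ℝ} {f u : ℝ → EuclideanSpace ℝ (Fin 3) → EuclideanSpace ℝ (Fin 3)}
  {p : ℝ → EuclideanSpace ℝ (Fin 3) → ℝ}

/-- **The enstrophy inequality at a fixed time, WITH FORCE** (Tao 2011, proof of Thm. 10.1,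
"collecting the bounds for `Y₁, …, Y₆`", annular form): for a classical solution of the FORCED
unit-viscosity system on the closed slab, a time `τ`, the annular ramp `η` of slope
`k = c^{-1/10}δ²` with radii `0 < R₁' ≤ a`, `a + 2k⁻¹ < b ≤ R₂'`, a speed bound `|u(τ)| ≤ s` and
the energy bound `∫|u(τ)|² ≤ 2E`, the production minus the recession term is at most
`−Y₁ + K(c^{1/20}δ⁻¹W^{1/2}Y₁ + c^{-3/20}δ³W^{3/2} + c^{3/4}W/T + a W^{1/2} + b)` with the force rate
`a = √2‖∇ × f(τ)‖_{L²({R₁'<|x−x₀|<R₂'})}` ("`|Y₅| ≲ W^{1/2}a(t)`") and the heat-flux majorant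
`b = (k/2)(a²S(a) + b²S(b)) + (k/R₁')∫_{R₁'<‖x−x₀‖<R₂'}|ω|²`. The `f = 0` case is the tree's
`enstrophyProduction_sub_recession_le`; the proof is the same with `Y₅` kept
(`integral_inner_curl_mul_weight_le_forceRate`). [cite: Tao2011, §10, proof of Thm. 10.1 ((10.11)–(10.14), the bound on Y₅, (10.19)–(10.23))] -/
theorem enstrophyProduction_sub_recession_le_forced (hT : 0 < T)
    (hsol : FluidPDE.IsClassicalNSSolutionOn (Icc 0 T) 1 f u p)
    {K c δ E k : ℝ} (hK : 1 ≤ K) (hc : 0 < c) (hc1 : c ≤ 1) (hδ : 0 < δ) (hE : 0 ≤ E)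
    (hk : k = c ^ (-(1 / 10 : ℝ)) * δ ^ 2) (habs : c + K * c ^ (9 / 10 : ℝ) ≤ 1)
    (hY : tao2011_nonlinearEstimateWith K) (hsmall : δ ^ 5 * Real.sqrt E * T ≤ c)
    {τ : ℝ} (hτ : τ ∈ Icc 0 T) (hEτ : ∫⁻ x, ‖u τ x‖ₑ ^ 2 ≤ ENNReal.ofReal (2 * E))
    {s : ℝ} (hs : ∀ x, ‖u τ x‖ ≤ s) (x₀ : EuclideanSpace ℝ (Fin 3)) {R₁' R₂' a b : ℝ}
    (hR₁ : 0 < R₁') (ha : R₁' ≤ a) (hab : a + 2 * k⁻¹ < b) (hb : b ≤ R₂') :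
    (∫ x, enstrophyProduction T u τ x * annularRamp k a b ‖x - x₀‖) -
        k / c * s * (1 / 2 * ∫ x in {x : EuclideanSpace ℝ (Fin 3) |
          (a < ‖x - x₀‖ ∧ ‖x - x₀‖ < a + k⁻¹) ∨ (b - k⁻¹ < ‖x - x₀‖ ∧ ‖x - x₀‖ < b)},
            ‖FluidPDE.curl (u τ) x‖ ^ 2) ≤
      -localisedEnstrophyDissipation (fun x => annularRamp k a b ‖x - x₀‖) (u τ) +
        K * (c ^ (1 / 20 : ℝ) * δ⁻¹ *
              Real.sqrt (localisedEnstrophy (fun x => annularRamp k a b ‖x - x₀‖) (u τ)) *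
              localisedEnstrophyDissipation (fun x => annularRamp k a b ‖x - x₀‖) (u τ) +
            c ^ (-(3 / 20 : ℝ)) * δ ^ 3 *
              (localisedEnstrophy (fun x => annularRamp k a b ‖x - x₀‖) (u τ) *
                Real.sqrt (localisedEnstrophy (fun x => annularRamp k a b ‖x - x₀‖) (u τ))) +
            c ^ (3 / 4 : ℝ) * localisedEnstrophy (fun x => annularRamp k a b ‖x - x₀‖) (u τ) / T +
            (Real.sqrt 2 * Real.sqrt (∫ x in {x : EuclideanSpace ℝ (Fin 3) |
                R₁' < ‖x - x₀‖ ∧ ‖x - x₀‖ < R₂'}, ‖FluidPDE.curl (f τ) x‖ ^ 2)) *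
              Real.sqrt (localisedEnstrophy (fun x => annularRamp k a b ‖x - x₀‖) (u τ)) +
            (k / 2 * (a ^ 2 * sphereNormSq (FluidPDE.curl (u τ)) x₀ a +
                b ^ 2 * sphereNormSq (FluidPDE.curl (u τ)) x₀ b) +
              k / R₁' * ∫ x in {x : EuclideanSpace ℝ (Fin 3) | R₁' < ‖x - x₀‖ ∧ ‖x - x₀‖ < R₂'},
                ‖FluidPDE.curl (u τ) x‖ ^ 2)) := by
  -- positivity of the slope and the geometry of the radii
  have hU : UniqueDiffOn ℝ (Icc 0 T) := uniqueDiffOn_Icc hT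
  have hk0 : 0 < k := by rw [hk]; positivity
  have hki : 0 < k⁻¹ := inv_pos.2 hk0
  have ha0 : 0 < a := hR₁.trans_le ha
  have hab' : a + k⁻¹ < b - k⁻¹ := by linarith
  have hbR : a + k⁻¹ ≤ R₂' := by linarith
  -- regularity of the slices
  have hu : ContDiff ℝ ∞ (u τ) := hsol.contDiff_velocity hτ
  have hζ1 : ContDiff ℝ 1 (FluidPDE.curl (u τ)) := FluidPDE.contDiff_curl (n := 1) (hu.of_le (by norm_cast))
  have hζc : Continuous (FluidPDE.curl (u τ)) := hζ1.continuous
  have hf1 : ContDiff ℝ 1 (f τ) :=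
    ((hsol.isSmoothSpaceTimeOn_force hU).contDiff_slice hτ).of_le (by norm_cast)
  have hcf : Continuous (FluidPDE.curl (f τ)) := FluidPDE.continuous_curl hf1
  obtain ⟨hL2i, hL2⟩ := integral_norm_sq_le_of_lintegral_le (hu.continuous) hE hEτ
  have hs0 : 0 ≤ s := (norm_nonneg _).trans (hs x₀)
  -- the weight (through the moving-cutoff API with frozen radii)
  set η : EuclideanSpace ℝ (Fin 3) → ℝ := fun x => annularRamp k a b ‖x - x₀‖ with hηdef
  have hlip : LipschitzWith (Real.toNNReal k) η :=
    lipschitzWith_movingCutoff hk0.le x₀ (fun _ => a) (fun _ => b) 0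
  have hηc : HasCompactSupport η := hasCompactSupport_movingCutoff (ρ₁ := fun _ => a)
    (ρ₂ := fun _ => b) (t := 0) hk0.le
  have hη0 : ∀ x, 0 ≤ η x := fun x => annularRamp_nonneg _ _ _ _
  have hη1 : ∀ x, η x ≤ 1 := fun x => annularRamp_le_one _ _ _ _
  -- (10.11): the identity, with the force term `Y₅` kept
  have hid := integral_enstrophyProduction_mul_weight hT hsol hτ hlip hηc
  rw [one_mul, one_mul] at hid
  have hY₁eq : localisedEnstrophyDissipation η (u τ) =
      ∫ x, FluidPDE.frobeniusNormSq (fderiv ℝ (FluidPDE.curl (u τ)) x) * η x := rfl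
  rw [← hY₁eq] at hid
  -- Y₃ ≤ heat-flux majorant
  have hY3 := heatFlux_le (ζ := FluidPDE.curl (u τ)) (x₀ := x₀) hζ1 zero_le_one hk0 ha0 hab'
  rw [one_mul, one_mul, ← hηdef] at hY3
  have hcurv := mul_setIntegral_layer_inv_norm_le hζc x₀ (ℓ := k⁻¹) hk0.le hR₁ ha hbR
  -- |Y₄| ≤ c Y₂
  have hY4 := integral_norm_sq_mul_lineDeriv_annularRamp_le (U := u τ) hζc hk0 ha0 hab' hs x₀
  rw [← hηdef] at hY4
  -- Y₅ ≤ a √W (Cauchy–Schwarz)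
  have hshell : MeasurableSet {x : EuclideanSpace ℝ (Fin 3) | R₁' < ‖x - x₀‖ ∧ ‖x - x₀‖ < R₂'} :=
    measurableSet_shell_centre x₀ R₁' R₂'
  have hgS : IntegrableOn (fun x => ‖FluidPDE.curl (f τ) x‖ ^ 2)
      {x : EuclideanSpace ℝ (Fin 3) | R₁' < ‖x - x₀‖ ∧ ‖x - x₀‖ < R₂'} volume :=
    (((hcf.norm.pow 2).continuousOn).integrableOn_compact
      (isCompact_closedBall x₀ R₂')).mono_set fun x hx => by
        rw [Metric.mem_closedBall, dist_eq_norm]; exact hx.2.le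
  have hsuppη : ∀ x, η x ≠ 0 → x ∈ {x : EuclideanSpace ℝ (Fin 3) | R₁' < ‖x - x₀‖ ∧ ‖x - x₀‖ < R₂'} := by
    intro x hx
    refine ⟨?_, ?_⟩
    · by_contra h
      exact hx (annularRamp_eq_zero_of_le_inner hk0.le ((not_lt.1 h).trans ha))
    · by_contra h
      exact hx (annularRamp_eq_zero_of_outer_le hk0.le (hb.trans (not_lt.1 h)))
  have hY5 := integral_inner_curl_mul_weight_le_forceRate (v := u τ) hζc hcf hlip.continuous hηc hη0
    hη1 hshell hgS hsuppη
  -- the nonlinear estimate for Y₆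
  have hab_k : a + 2 * (c ^ (-(1 / 10 : ℝ)) * δ ^ 2)⁻¹ < b := by rw [← hk]; exact hab
  have hY6 := hY hc hc1 hδ hT hE hsmall hu (hsol.divFree τ hτ) hL2 hL2i hs x₀ ha0 hab_k
  rw [← hk] at hY6
  rw [← hηdef] at hY6
  have hY6' := (le_abs_self _).trans hY6
  -- name the atoms
  set W : ℝ := localisedEnstrophy η (u τ) with hWdef
  set Y₁ : ℝ := localisedEnstrophyDissipation η (u τ) with hY₁def
  set IL : ℝ := ∫ x in {x : EuclideanSpace ℝ (Fin 3) |
      (a < ‖x - x₀‖ ∧ ‖x - x₀‖ < a + k⁻¹) ∨ (b - k⁻¹ < ‖x - x₀‖ ∧ ‖x - x₀‖ < b)},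
        ‖FluidPDE.curl (u τ) x‖ ^ 2 with hILdef
  set IS : ℝ := ∫ x in {x : EuclideanSpace ℝ (Fin 3) | R₁' < ‖x - x₀‖ ∧ ‖x - x₀‖ < R₂'},
      ‖FluidPDE.curl (u τ) x‖ ^ 2 with hISdef
  set A5 : ℝ := Real.sqrt 2 * Real.sqrt (∫ x in {x : EuclideanSpace ℝ (Fin 3) |
      R₁' < ‖x - x₀‖ ∧ ‖x - x₀‖ < R₂'}, ‖FluidPDE.curl (f τ) x‖ ^ 2) with hA5def
  set Sa : ℝ := sphereNormSq (FluidPDE.curl (u τ)) x₀ a with hSadef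
  set Sb : ℝ := sphereNormSq (FluidPDE.curl (u τ)) x₀ b with hSbdef
  have hW0 : 0 ≤ W := localisedEnstrophy_nonneg hη0 _
  have hY₁0 : 0 ≤ Y₁ := localisedEnstrophyDissipation_nonneg hη0 _
  have hIL0 : 0 ≤ IL := setIntegral_nonneg (measurableSet_layers x₀ k a b) fun x _ => sq_nonneg _
  have hIS0 : 0 ≤ IS := setIntegral_nonneg hshell fun x _ => sq_nonneg _
  have hA50 : 0 ≤ A5 := by positivity
  have hSa : 0 ≤ Sa := sphereNormSq_nonneg (FluidPDE.curl (u τ)) x₀ a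
  have hSb : 0 ≤ Sb := sphereNormSq_nonneg (FluidPDE.curl (u τ)) x₀ b
  -- the force term is paid by `K a √W` since `K ≥ 1`
  have hY5K : A5 * Real.sqrt W ≤ K * (A5 * Real.sqrt W) :=
    le_mul_of_one_le_left (mul_nonneg hA50 (Real.sqrt_nonneg _)) hK
  -- absorption of the layer terms into the recession term
  have hlayer : 1 / 2 * (k * s * IL) + K * c ^ (9 / 10 : ℝ) * (k / (2 * c) * s * IL) -
      k / c * s * (1 / 2 * IL) = (s * k * IL) / (2 * c) * (c + K * c ^ (9 / 10 : ℝ) - 1) := by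
    field_simp
  have hIL_comb : 1 / 2 * (k * s * IL) + K * c ^ (9 / 10 : ℝ) * (k / (2 * c) * s * IL) -
      k / c * s * (1 / 2 * IL) ≤ 0 := by
    rw [hlayer]
    exact mul_nonpos_of_nonneg_of_nonpos (by positivity) (by linarith)
  -- the heat-flux majorant is nonnegative and `K ≥ 1`
  have hbflux0 : 0 ≤ k / 2 * (a ^ 2 * Sa + b ^ 2 * Sb) + k / R₁' * IS := by positivity
  have hbflux : k / 2 * (a ^ 2 * Sa + b ^ 2 * Sb) + k / R₁' * IS ≤
      K * (k / 2 * (a ^ 2 * Sa + b ^ 2 * Sb) + k / R₁' * IS) :=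
    le_mul_of_one_le_left hbflux0 hK
  -- bookkeeping identities aligning the two parenthesisations
  have e1 : K * (c ^ (1 / 20 : ℝ) * δ⁻¹ * Real.sqrt W * Y₁ +
        c ^ (-(3 / 20 : ℝ)) * δ ^ 3 * (W * Real.sqrt W) + c ^ (3 / 4 : ℝ) * W / T +
        A5 * Real.sqrt W + (k / 2 * (a ^ 2 * Sa + b ^ 2 * Sb) + k / R₁' * IS)) =
      K * (c ^ (1 / 20 : ℝ) * δ⁻¹ * (Real.sqrt W * Y₁)) +
        K * (c ^ (-(3 / 20 : ℝ)) * δ ^ 3 * (W * Real.sqrt W)) + K * (c ^ (3 / 4 : ℝ) * W / T) +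
        K * (A5 * Real.sqrt W) +
        K * (k / 2 * (a ^ 2 * Sa + b ^ 2 * Sb) + k / R₁' * IS) := by ring
  have e2 : K * (c ^ (-(3 / 20 : ℝ)) * δ ^ 3 * (W * Real.sqrt W) +
        c ^ (1 / 20 : ℝ) * δ⁻¹ * (Real.sqrt W * Y₁) + c ^ (3 / 4 : ℝ) * W / T) +
        K * c ^ (9 / 10 : ℝ) * (k / (2 * c) * s * IL) =
      K * (c ^ (1 / 20 : ℝ) * δ⁻¹ * (Real.sqrt W * Y₁)) +
        K * (c ^ (-(3 / 20 : ℝ)) * δ ^ 3 * (W * Real.sqrt W)) + K * (c ^ (3 / 4 : ℝ) * W / T) +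
        K * c ^ (9 / 10 : ℝ) * (k / (2 * c) * s * IL) := by ring
  rw [hid]
  linarith [hY3, hcurv, hY4, hY5, hY5K, hY6', hIL_comb, hbflux, e1, e2]

/-- **Continuity of the heat-flux majorant** along the speed-driven radii on `[0, T]`, for a field
smooth on the closed slab with finite total speed (the tree's `continuousOn_heatFluxMajorant`, stated
for the smoothness hypothesis instead of an unforced solution). [cite: Tao2011, §10, proof of Thm. 10.1 (the quantity b(t))] -/
theorem continuousOn_heatFluxMajorant_of_smooth (hT : 0 < T)
    (hu : FluidPDE.IsSmoothSpaceTimeOn (Icc 0 T) u) {M : ℝ}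
    (hMt : ∫⁻ t in Ioo 0 T, eLpNorm (u t) ∞ volume ≤ ENNReal.ofReal M) (x₀ : EuclideanSpace ℝ (Fin 3))
    {k c R₁' R₂' : ℝ} (hR₁ : 0 ≤ R₁') :
    ContinuousOn (fun t => k / 2 * ((R₁' + speedIntegral u t / c) ^ 2 *
        sphereNormSq (FluidPDE.curl (u t)) x₀ (R₁' + speedIntegral u t / c) +
        (R₂' - speedIntegral u t / c) ^ 2 *
          sphereNormSq (FluidPDE.curl (u t)) x₀ (R₂' - speedIntegral u t / c)) +
      k / R₁' * ∫ x in {x : EuclideanSpace ℝ (Fin 3) | R₁' < ‖x - x₀‖ ∧ ‖x - x₀‖ < R₂'},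
        ‖FluidPDE.curl (u t) x‖ ^ 2) (Icc 0 T) := by
  obtain ⟨h₁, h₂⟩ := continuousOn_speedRadii hT hu hMt c R₁' R₂'
  have hs₁ := continuousOn_sq_mul_sphereNormSq_curl hT hu x₀ h₁
  have hs₂ := continuousOn_sq_mul_sphereNormSq_curl hT hu x₀ h₂
  have hsh := continuousOn_setIntegral_shell_curl_sq hT hu x₀ (b := R₂') hR₁
  exact (continuousOn_const.mul (hs₁.add hs₂)).add (continuousOn_const.mul hsh)

end StaticRate

/-! ## The integrated inequality along the moving cutoff, with force -/

section Integrated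

variable {T : ℝ} {f u : ℝ → EuclideanSpace ℝ (Fin 3) → EuclideanSpace ℝ (Fin 3)}
  {p : ℝ → EuclideanSpace ℝ (Fin 3) → ℝ}

/-- **Tao 2011, proof of Thm. 10.1: the integrated enstrophy inequality, WITH FORCE** (annular
form, unit viscosity). Along the moving cutoff `η(t) = annularRamp k (R₁' + σ(t)/c) (R₂' − σ(t)/c) ‖· − x₀‖`
with `σ(t) = ∫₀ᵗ‖u‖_{L^∞}`, `k = c^{-1/10}δ²`, for a classical solution of the FORCED unit-viscosity
system with `sup_t ∫|u|² ≤ 2E`, `∫₀ᵀ‖u‖_{L^∞} ≤ M` and the gap `R₁' + M/c + 2k⁻¹ < R₂' − M/c`, and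
under the smallness `δ⁵E^{1/2}T ≤ c` and the absorption condition `c + Kc^{9/10} ≤ 1`: for
`t ∈ [0,T]`,
`W(t) + ∫₀ᵗ Y₁ ≤ W(0) + ∫₀ᵗ K(c^{1/20}δ⁻¹W^{1/2}Y₁ + c^{-3/20}δ³W^{3/2} + c^{3/4}W/T + a W^{1/2} + b)`
with the force rate `a(s) = √2‖∇ × f(s)‖_{L²({R₁'<|x−x₀|<R₂'})}` and `b` the heat-flux majorant —
the integrated form of "`∂ₜW ≤ −Y₁ + O(c^{0.05}δ⁻¹W^{1/2}Y₁ + c^{-0.15}δ³W^{3/2} + c^{0.75}W/T +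
a(t)W^{1/2} + b(t))`" (arXiv p. 33), obtained from the kinematic identity
`localisedEnstrophy_movingCutoff_sub_eq` and the fixed-time inequality
`enstrophyProduction_sub_recession_le_forced` at almost every time. The `f = 0` case is the tree's
`localisedEnstrophy_add_intervalIntegral_le`. [cite: Tao2011, §10, proof of Thm. 10.1 ((10.11)–(10.23), the bound on Y₅)] -/
theorem localisedEnstrophy_add_intervalIntegral_le_forced (hT : 0 < T)
    (hsol : FluidPDE.IsClassicalNSSolutionOn (Icc 0 T) 1 f u p)
    {K c δ E M k : ℝ} (hK : 1 ≤ K) (hc : 0 < c) (hc1 : c ≤ 1) (hδ : 0 < δ) (hE : 0 ≤ E)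
    (hM : 0 ≤ M) (hk : k = c ^ (-(1 / 10 : ℝ)) * δ ^ 2) (habs : c + K * c ^ (9 / 10 : ℝ) ≤ 1)
    (hY : tao2011_nonlinearEstimateWith K) (hsmall : δ ^ 5 * Real.sqrt E * T ≤ c)
    (hEt : ∀ t ∈ Icc 0 T, ∫⁻ x, ‖u t x‖ₑ ^ 2 ≤ ENNReal.ofReal (2 * E))
    (hMt : ∫⁻ t in Ioo 0 T, eLpNorm (u t) ∞ volume ≤ ENNReal.ofReal M)
    (x₀ : EuclideanSpace ℝ (Fin 3)) {R₁' R₂' : ℝ} (hR₁ : 0 < R₁')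
    (hgap : R₁' + M / c + 2 * k⁻¹ < R₂' - M / c) {t : ℝ} (ht : t ∈ Icc 0 T) :
    localisedEnstrophy (movingCutoff x₀ k (fun t => R₁' + speedIntegral u t / c)
        (fun t => R₂' - speedIntegral u t / c) t) (u t) +
      ∫ s in (0)..t, localisedEnstrophyDissipation (movingCutoff x₀ k
        (fun t => R₁' + speedIntegral u t / c) (fun t => R₂' - speedIntegral u t / c) s) (u s) ≤
    localisedEnstrophy (movingCutoff x₀ k (fun t => R₁' + speedIntegral u t / c)
        (fun t => R₂' - speedIntegral u t / c) 0) (u 0) +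
      ∫ s in (0)..t, K * (c ^ (1 / 20 : ℝ) * δ⁻¹ *
          Real.sqrt (localisedEnstrophy (movingCutoff x₀ k (fun t => R₁' + speedIntegral u t / c)
            (fun t => R₂' - speedIntegral u t / c) s) (u s)) *
          localisedEnstrophyDissipation (movingCutoff x₀ k (fun t => R₁' + speedIntegral u t / c)
            (fun t => R₂' - speedIntegral u t / c) s) (u s) +
        c ^ (-(3 / 20 : ℝ)) * δ ^ 3 *
          (localisedEnstrophy (movingCutoff x₀ k (fun t => R₁' + speedIntegral u t / c)
              (fun t => R₂' - speedIntegral u t / c) s) (u s) *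
            Real.sqrt (localisedEnstrophy (movingCutoff x₀ k (fun t => R₁' + speedIntegral u t / c)
              (fun t => R₂' - speedIntegral u t / c) s) (u s))) +
        c ^ (3 / 4 : ℝ) * localisedEnstrophy (movingCutoff x₀ k (fun t => R₁' + speedIntegral u t / c)
            (fun t => R₂' - speedIntegral u t / c) s) (u s) / T +
        (Real.sqrt 2 * Real.sqrt (∫ x in {x : EuclideanSpace ℝ (Fin 3) |
                R₁' < ‖x - x₀‖ ∧ ‖x - x₀‖ < R₂'}, ‖FluidPDE.curl (f s) x‖ ^ 2)) *
              Real.sqrt (localisedEnstrophy (movingCutoff x₀ k (fun t => R₁' + speedIntegral u t / c)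
            (fun t => R₂' - speedIntegral u t / c) s) (u s)) +
        (k / 2 * ((R₁' + speedIntegral u s / c) ^ 2 *
            sphereNormSq (FluidPDE.curl (u s)) x₀ (R₁' + speedIntegral u s / c) +
            (R₂' - speedIntegral u s / c) ^ 2 *
              sphereNormSq (FluidPDE.curl (u s)) x₀ (R₂' - speedIntegral u s / c)) +
          k / R₁' * ∫ x in {x : EuclideanSpace ℝ (Fin 3) | R₁' < ‖x - x₀‖ ∧ ‖x - x₀‖ < R₂'},
            ‖FluidPDE.curl (u s) x‖ ^ 2)) := by
  have hk0 : 0 < k := by rw [hk]; positivity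
  have hki : 0 < k⁻¹ := inv_pos.2 hk0
  have hu := hsol.smooth_velocity
  -- the speed integral
  have hσac := absolutelyContinuousOnInterval_speedIntegral hT hu hMt
  have hσ0 : ∀ s ∈ Icc 0 T, 0 ≤ speedIntegral u s := fun s hs => speedIntegral_nonneg hT hu hMt hs
  have hσM : ∀ s ∈ Icc 0 T, speedIntegral u s ≤ M := fun s hs => speedIntegral_le_of_mem hT hM hu hMt hs
  have hσd := ae_hasDerivAt_speedIntegral hT hu hMt
  have hgap' : R₁' + M / c + k⁻¹ < R₂' - M / c - k⁻¹ := by linarith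
  obtain ⟨hρ₁c, hρ₂c⟩ := continuousOn_speedRadii hT hu hMt c R₁' R₂'
  have hρ₂le : ∀ s ∈ Icc 0 T, R₂' - speedIntegral u s / c ≤ R₂' := fun s hs => by
    have := div_nonneg (hσ0 s hs) hc.le; linarith
  -- continuity of W, Y₁ and b on [0, T]
  have hWc := continuousOn_localisedEnstrophy_movingCutoff (x₀ := x₀) hT hsol hk0.le hρ₁c hρ₂c hρ₂le
  have hYc := continuousOn_localisedEnstrophyDissipation_movingCutoff (x₀ := x₀) hT hsol hk0.le hρ₁c
    hρ₂c hρ₂le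
  have hbc := continuousOn_heatFluxMajorant_of_smooth (k := k) (c := c) (R₂' := R₂') hT hu hMt x₀ hR₁.le
  have hfsm : FluidPDE.IsSmoothSpaceTimeOn (Icc 0 T) f := hsol.isSmoothSpaceTimeOn_force (uniqueDiffOn_Icc hT)
  have hac := continuousOn_forceRate hT hfsm x₀ (R₁' := R₁') (R₂' := R₂') hR₁.le
  -- the kinematic identity and integrability of the rate
  have hid := localisedEnstrophy_movingCutoff_sub_eq (x₀ := x₀) hT hu hk0 hc hσac hσ0 hσM hσd hgap'
    le_rfl ht.1 ht.2
  have hrate := intervalIntegrable_localisedEnstrophy_rate (x₀ := x₀) hT hu hk0 hc hσac hσ0 hσM hσd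
    hgap' le_rfl ht.1 ht.2
  -- the fixed-time inequality, at almost every time of `[0, t]`
  have hgood : ∀ᵐ τ ∂(volume.restrict (Icc 0 t)), ∀ x, ‖u τ x‖ ≤ speed u τ := by
    have h1 := (ae_restrict_iff' measurableSet_Ioo).1 (ae_norm_le_speed hu hMt)
    have h0 : ∀ᵐ τ : ℝ, τ ≠ 0 := by simp [ae_iff, measure_singleton]
    have hTne : ∀ᵐ τ : ℝ, τ ≠ T := by simp [ae_iff, measure_singleton]
    refine (ae_restrict_iff' measurableSet_Icc).2 ?_
    filter_upwards [h1, h0, hTne] with τ h1 h0 hTne hτ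
    exact h1 ⟨lt_of_le_of_ne hτ.1 (Ne.symm h0), lt_of_le_of_ne (hτ.2.trans ht.2) hTne⟩
  have hpt : ∀ᵐ τ ∂(volume.restrict (Icc 0 t)),
      (∫ x, enstrophyProduction T u τ x * movingCutoff x₀ k (fun t => R₁' + speedIntegral u t / c)
          (fun t => R₂' - speedIntegral u t / c) τ x) -
        k / c * speed u τ * (1 / 2 * ∫ x in transitionLayers x₀ k c R₁' R₂' (speedIntegral u τ),
          ‖FluidPDE.curl (u τ) x‖ ^ 2) ≤
      -localisedEnstrophyDissipation (movingCutoff x₀ k (fun t => R₁' + speedIntegral u t / c)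
          (fun t => R₂' - speedIntegral u t / c) τ) (u τ) +
        K * (c ^ (1 / 20 : ℝ) * δ⁻¹ *
          Real.sqrt (localisedEnstrophy (movingCutoff x₀ k (fun t => R₁' + speedIntegral u t / c)
            (fun t => R₂' - speedIntegral u t / c) τ) (u τ)) *
          localisedEnstrophyDissipation (movingCutoff x₀ k (fun t => R₁' + speedIntegral u t / c)
            (fun t => R₂' - speedIntegral u t / c) τ) (u τ) +
        c ^ (-(3 / 20 : ℝ)) * δ ^ 3 *
          (localisedEnstrophy (movingCutoff x₀ k (fun t => R₁' + speedIntegral u t / c)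
              (fun t => R₂' - speedIntegral u t / c) τ) (u τ) *
            Real.sqrt (localisedEnstrophy (movingCutoff x₀ k (fun t => R₁' + speedIntegral u t / c)
              (fun t => R₂' - speedIntegral u t / c) τ) (u τ))) +
        c ^ (3 / 4 : ℝ) * localisedEnstrophy (movingCutoff x₀ k (fun t => R₁' + speedIntegral u t / c)
            (fun t => R₂' - speedIntegral u t / c) τ) (u τ) / T +
        (Real.sqrt 2 * Real.sqrt (∫ x in {x : EuclideanSpace ℝ (Fin 3) |
                R₁' < ‖x - x₀‖ ∧ ‖x - x₀‖ < R₂'}, ‖FluidPDE.curl (f τ) x‖ ^ 2)) *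
              Real.sqrt (localisedEnstrophy (movingCutoff x₀ k (fun t => R₁' + speedIntegral u t / c)
            (fun t => R₂' - speedIntegral u t / c) τ) (u τ)) +
        (k / 2 * ((R₁' + speedIntegral u τ / c) ^ 2 *
            sphereNormSq (FluidPDE.curl (u τ)) x₀ (R₁' + speedIntegral u τ / c) +
            (R₂' - speedIntegral u τ / c) ^ 2 *
              sphereNormSq (FluidPDE.curl (u τ)) x₀ (R₂' - speedIntegral u τ / c)) +
          k / R₁' * ∫ x in {x : EuclideanSpace ℝ (Fin 3) | R₁' < ‖x - x₀‖ ∧ ‖x - x₀‖ < R₂'},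
            ‖FluidPDE.curl (u τ) x‖ ^ 2)) := by
    filter_upwards [hgood, ae_restrict_mem measurableSet_Icc] with τ hτs hτt
    have hτ : τ ∈ Icc 0 T := ⟨hτt.1, hτt.2.trans ht.2⟩
    have ha : R₁' ≤ R₁' + speedIntegral u τ / c := by
      have := div_nonneg (hσ0 τ hτ) hc.le; linarith
    have hab : R₁' + speedIntegral u τ / c + 2 * k⁻¹ < R₂' - speedIntegral u τ / c := by
      have : speedIntegral u τ / c ≤ M / c := div_le_div_of_nonneg_right (hσM τ hτ) hc.le
      linarith
    have hst := enstrophyProduction_sub_recession_le_forced hT hsol hK hc hc1 hδ hE hk habs hY hsmall hτ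
      (hEt τ hτ) hτs x₀ hR₁ ha hab (hρ₂le τ hτ)
    rw [transitionLayers_eq_setOf]
    exact hst
  -- integrate the fixed-time inequality over `[0, t]`
  have hG'i : IntervalIntegrable (fun τ => K * (c ^ (1 / 20 : ℝ) * δ⁻¹ *
          Real.sqrt (localisedEnstrophy (movingCutoff x₀ k (fun t => R₁' + speedIntegral u t / c)
            (fun t => R₂' - speedIntegral u t / c) τ) (u τ)) *
          localisedEnstrophyDissipation (movingCutoff x₀ k (fun t => R₁' + speedIntegral u t / c)
            (fun t => R₂' - speedIntegral u t / c) τ) (u τ) +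
        c ^ (-(3 / 20 : ℝ)) * δ ^ 3 *
          (localisedEnstrophy (movingCutoff x₀ k (fun t => R₁' + speedIntegral u t / c)
              (fun t => R₂' - speedIntegral u t / c) τ) (u τ) *
            Real.sqrt (localisedEnstrophy (movingCutoff x₀ k (fun t => R₁' + speedIntegral u t / c)
              (fun t => R₂' - speedIntegral u t / c) τ) (u τ))) +
        c ^ (3 / 4 : ℝ) * localisedEnstrophy (movingCutoff x₀ k (fun t => R₁' + speedIntegral u t / c)
            (fun t => R₂' - speedIntegral u t / c) τ) (u τ) / T +
        (Real.sqrt 2 * Real.sqrt (∫ x in {x : EuclideanSpace ℝ (Fin 3) |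
                R₁' < ‖x - x₀‖ ∧ ‖x - x₀‖ < R₂'}, ‖FluidPDE.curl (f τ) x‖ ^ 2)) *
              Real.sqrt (localisedEnstrophy (movingCutoff x₀ k (fun t => R₁' + speedIntegral u t / c)
            (fun t => R₂' - speedIntegral u t / c) τ) (u τ)) +
        (k / 2 * ((R₁' + speedIntegral u τ / c) ^ 2 *
            sphereNormSq (FluidPDE.curl (u τ)) x₀ (R₁' + speedIntegral u τ / c) +
            (R₂' - speedIntegral u τ / c) ^ 2 *
              sphereNormSq (FluidPDE.curl (u τ)) x₀ (R₂' - speedIntegral u τ / c)) +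
          k / R₁' * ∫ x in {x : EuclideanSpace ℝ (Fin 3) | R₁' < ‖x - x₀‖ ∧ ‖x - x₀‖ < R₂'},
            ‖FluidPDE.curl (u τ) x‖ ^ 2))) volume 0 t := by
    refine ((continuousOn_const.mul ?_).mono (Icc_subset_Icc le_rfl ht.2)).intervalIntegrable_of_Icc ht.1
    exact ((((((continuousOn_const.mul hWc.sqrt).mul hYc).add
      (continuousOn_const.mul (hWc.mul hWc.sqrt))).add ((continuousOn_const.mul hWc).div_const T)).add
      (hac.mul hWc.sqrt)).add hbc)
  have hYi : IntervalIntegrable (fun τ => localisedEnstrophyDissipation (movingCutoff x₀ k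
      (fun t => R₁' + speedIntegral u t / c) (fun t => R₂' - speedIntegral u t / c) τ) (u τ)) volume 0 t :=
    (hYc.mono (Icc_subset_Icc le_rfl ht.2)).intervalIntegrable_of_Icc ht.1
  have hRi : IntervalIntegrable (fun τ => -localisedEnstrophyDissipation (movingCutoff x₀ k
      (fun t => R₁' + speedIntegral u t / c) (fun t => R₂' - speedIntegral u t / c) τ) (u τ) + K * (c ^ (1 / 20 : ℝ) * δ⁻¹ *
          Real.sqrt (localisedEnstrophy (movingCutoff x₀ k (fun t => R₁' + speedIntegral u t / c)
            (fun t => R₂' - speedIntegral u t / c) τ) (u τ)) *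
          localisedEnstrophyDissipation (movingCutoff x₀ k (fun t => R₁' + speedIntegral u t / c)
            (fun t => R₂' - speedIntegral u t / c) τ) (u τ) +
        c ^ (-(3 / 20 : ℝ)) * δ ^ 3 *
          (localisedEnstrophy (movingCutoff x₀ k (fun t => R₁' + speedIntegral u t / c)
              (fun t => R₂' - speedIntegral u t / c) τ) (u τ) *
            Real.sqrt (localisedEnstrophy (movingCutoff x₀ k (fun t => R₁' + speedIntegral u t / c)
              (fun t => R₂' - speedIntegral u t / c) τ) (u τ))) +
        c ^ (3 / 4 : ℝ) * localisedEnstrophy (movingCutoff x₀ k (fun t => R₁' + speedIntegral u t / c)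
            (fun t => R₂' - speedIntegral u t / c) τ) (u τ) / T +
        (Real.sqrt 2 * Real.sqrt (∫ x in {x : EuclideanSpace ℝ (Fin 3) |
                R₁' < ‖x - x₀‖ ∧ ‖x - x₀‖ < R₂'}, ‖FluidPDE.curl (f τ) x‖ ^ 2)) *
              Real.sqrt (localisedEnstrophy (movingCutoff x₀ k (fun t => R₁' + speedIntegral u t / c)
            (fun t => R₂' - speedIntegral u t / c) τ) (u τ)) +
        (k / 2 * ((R₁' + speedIntegral u τ / c) ^ 2 *
            sphereNormSq (FluidPDE.curl (u τ)) x₀ (R₁' + speedIntegral u τ / c) +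
            (R₂' - speedIntegral u τ / c) ^ 2 *
              sphereNormSq (FluidPDE.curl (u τ)) x₀ (R₂' - speedIntegral u τ / c)) +
          k / R₁' * ∫ x in {x : EuclideanSpace ℝ (Fin 3) | R₁' < ‖x - x₀‖ ∧ ‖x - x₀‖ < R₂'},
            ‖FluidPDE.curl (u τ) x‖ ^ 2))) volume 0 t := hYi.neg.add hG'i
  have hmono := intervalIntegral.integral_mono_ae_restrict ht.1 hrate hRi hpt
  have hsplit : (∫ τ in (0)..t, (-localisedEnstrophyDissipation (movingCutoff x₀ k
      (fun t => R₁' + speedIntegral u t / c) (fun t => R₂' - speedIntegral u t / c) τ) (u τ) + K * (c ^ (1 / 20 : ℝ) * δ⁻¹ *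
          Real.sqrt (localisedEnstrophy (movingCutoff x₀ k (fun t => R₁' + speedIntegral u t / c)
            (fun t => R₂' - speedIntegral u t / c) τ) (u τ)) *
          localisedEnstrophyDissipation (movingCutoff x₀ k (fun t => R₁' + speedIntegral u t / c)
            (fun t => R₂' - speedIntegral u t / c) τ) (u τ) +
        c ^ (-(3 / 20 : ℝ)) * δ ^ 3 *
          (localisedEnstrophy (movingCutoff x₀ k (fun t => R₁' + speedIntegral u t / c)
              (fun t => R₂' - speedIntegral u t / c) τ) (u τ) *
            Real.sqrt (localisedEnstrophy (movingCutoff x₀ k (fun t => R₁' + speedIntegral u t / c)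
              (fun t => R₂' - speedIntegral u t / c) τ) (u τ))) +
        c ^ (3 / 4 : ℝ) * localisedEnstrophy (movingCutoff x₀ k (fun t => R₁' + speedIntegral u t / c)
            (fun t => R₂' - speedIntegral u t / c) τ) (u τ) / T +
        (Real.sqrt 2 * Real.sqrt (∫ x in {x : EuclideanSpace ℝ (Fin 3) |
                R₁' < ‖x - x₀‖ ∧ ‖x - x₀‖ < R₂'}, ‖FluidPDE.curl (f τ) x‖ ^ 2)) *
              Real.sqrt (localisedEnstrophy (movingCutoff x₀ k (fun t => R₁' + speedIntegral u t / c)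
            (fun t => R₂' - speedIntegral u t / c) τ) (u τ)) +
        (k / 2 * ((R₁' + speedIntegral u τ / c) ^ 2 *
            sphereNormSq (FluidPDE.curl (u τ)) x₀ (R₁' + speedIntegral u τ / c) +
            (R₂' - speedIntegral u τ / c) ^ 2 *
              sphereNormSq (FluidPDE.curl (u τ)) x₀ (R₂' - speedIntegral u τ / c)) +
          k / R₁' * ∫ x in {x : EuclideanSpace ℝ (Fin 3) | R₁' < ‖x - x₀‖ ∧ ‖x - x₀‖ < R₂'},
            ‖FluidPDE.curl (u τ) x‖ ^ 2)))) = -(∫ τ in (0)..t, localisedEnstrophyDissipation (movingCutoff x₀ k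
      (fun t => R₁' + speedIntegral u t / c) (fun t => R₂' - speedIntegral u t / c) τ) (u τ)) + ∫ τ in (0)..t, K * (c ^ (1 / 20 : ℝ) * δ⁻¹ *
          Real.sqrt (localisedEnstrophy (movingCutoff x₀ k (fun t => R₁' + speedIntegral u t / c)
            (fun t => R₂' - speedIntegral u t / c) τ) (u τ)) *
          localisedEnstrophyDissipation (movingCutoff x₀ k (fun t => R₁' + speedIntegral u t / c)
            (fun t => R₂' - speedIntegral u t / c) τ) (u τ) +
        c ^ (-(3 / 20 : ℝ)) * δ ^ 3 *
          (localisedEnstrophy (movingCutoff x₀ k (fun t => R₁' + speedIntegral u t / c)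
              (fun t => R₂' - speedIntegral u t / c) τ) (u τ) *
            Real.sqrt (localisedEnstrophy (movingCutoff x₀ k (fun t => R₁' + speedIntegral u t / c)
              (fun t => R₂' - speedIntegral u t / c) τ) (u τ))) +
        c ^ (3 / 4 : ℝ) * localisedEnstrophy (movingCutoff x₀ k (fun t => R₁' + speedIntegral u t / c)
            (fun t => R₂' - speedIntegral u t / c) τ) (u τ) / T +
        (Real.sqrt 2 * Real.sqrt (∫ x in {x : EuclideanSpace ℝ (Fin 3) |
                R₁' < ‖x - x₀‖ ∧ ‖x - x₀‖ < R₂'}, ‖FluidPDE.curl (f τ) x‖ ^ 2)) *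
              Real.sqrt (localisedEnstrophy (movingCutoff x₀ k (fun t => R₁' + speedIntegral u t / c)
            (fun t => R₂' - speedIntegral u t / c) τ) (u τ)) +
        (k / 2 * ((R₁' + speedIntegral u τ / c) ^ 2 *
            sphereNormSq (FluidPDE.curl (u τ)) x₀ (R₁' + speedIntegral u τ / c) +
            (R₂' - speedIntegral u τ / c) ^ 2 *
              sphereNormSq (FluidPDE.curl (u τ)) x₀ (R₂' - speedIntegral u τ / c)) +
          k / R₁' * ∫ x in {x : EuclideanSpace ℝ (Fin 3) | R₁' < ‖x - x₀‖ ∧ ‖x - x₀‖ < R₂'},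
            ‖FluidPDE.curl (u τ) x‖ ^ 2)) := by
    rw [intervalIntegral.integral_add (f := fun τ => -localisedEnstrophyDissipation (movingCutoff x₀ k
      (fun t => R₁' + speedIntegral u t / c) (fun t => R₂' - speedIntegral u t / c) τ) (u τ)) hYi.neg hG'i,
      intervalIntegral.integral_neg]
  linarith [hmono, hsplit, hid]

end Integrated

end Literature.Analysis.FluidPDE

end
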